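import Summits.HubbardSuperconductivity.HubbardSuperconductivity.Theorems.AnisotropyChordTransferFibre3RowCSharp
import Summits.HubbardSuperconductivity.HubbardSuperconductivity.Theorems.AnisotropyChordTransferFibre3RowCFactor
import Summits.HubbardSuperconductivity.HubbardSuperconductivity.Theorems.AnisotropyChordTransferFibre3RowCTSharp

/-!
# Route `AnisotropyChord` / H0 rotor rung, row C (KT-2b) on the t-BLOCKS `64 ≤ L < 128`: block twin of `…AnisotropyChordTransferFibre3RowCFactor`

T-FORK (p1 g32, route-lead ruling R4-b; p2's inventory memo HOME/hubbard-h0-rotor-p2/TBLOCK-INVENTORY-g8.md §3–§4): the declarations of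
`…RowCFactor` that carry the hypothesis `128 ≤ L` (or a constant that changes below `L = 128`, or the `L2.NamedCell` cell box) restated in the
namespace `RowC.T` with the SAME names for the t-blocks (route-lead ruling R1): analytic layer with `64 ≤ L` and the `L ≥ 64` numerics of p2 g8
(`ManifoldA.nu_ceiling64` (ν < .0359), `manifold_band64`, `second_shell_window64` (±.0012/±.003), `RowC.fmax_uniform64`/`gmin_uniform64`
(same constant .07 + .1ν), `third_shell_window64` (±.0031/±.01), `window_k10_64` ([.24993, .25]), `lam_increment_bound64` (δ = .0022)); cell layer on
block cells `c : L2.TCell` (`cellFinalBoxCB (c.box a₁ a₂)`, `pmem_xTrueT`, `RowC.finalVec_mem_of_cellFinalBoxT`).  Declarations that do not change are NOT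
duplicated (they resolve to `RowC`); proofs are verbatim up to the substitutions.
Prover seat `hubbard-h0-rotor-p1` g32 (route lead); helper for piece A = stmt-HubbardSuperconductivity-23918 of rung 19089 (`--supports`, helper
class).  Nothing here proves superconductivity in the Hubbard model; lemmas for ONE row of ONE conditional reduction on the t-blocks; the rotor TARGET
as originally worded stays FALSE (g15 verdict).  Mathlib + the tree only; no sorry.
-/

set_option linter.dupNamespace false
set_option autoImplicit false

open Literature.Analysis.ValidatedNumerics

namespace Summit.HubbardSuperconductivity.HubbardSuperconductivity.Theorems.AnisotropyChord.Transfer.Fibre3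

namespace RowC

namespace T

open L2.N1

variable (L : ℕ) [NeZero L]

/-- `δ/η = 1 + 0.001ĉ`. -/
def del1E : RExpr := .add (cst 1) (.mul (cst 0.0022) cHE)

/-- `bulk/η² = η·(17f²(δ/η)² + 8(ξ/η)²M² + 16(ζ/η)²M²)·(τ̄/η)`. -/
def bulk1E : RExpr :=
  .mul (.mul etaE (.add (.add (.mul (.mul (cst 17) (.sq fnnE)) (.sq del1E)) (.mul (.mul (cst 8) (.sq xi1E)) (.sq MNE)))
    (.mul (.mul (cst 16) (.sq ze1E)) (.sq MNE)))) tau1E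

/-- `Bxx/η² = ĉ²(0.0062a + 0.0021·η·ĉ)`, `Bxy/η²`. -/
def Bxx1E : RExpr := .mul (.sq cHE) (.add (.mul (cst 0.0062) yA) (.mul (.mul (cst 0.0021) etaE) cHE))

/-- see `Bxx1E`. -/
def Bxy1E : RExpr := .mul (.sq cHE) (.add (.mul (cst 0.0127) yA) (.mul (.mul (cst 0.0038) etaE) cHE))

/-- `ZwS/η² = η²(2(Bxx/η²)² + 4(Bxy/η²)²)`. -/
def ZwS1E : RExpr := .mul (.sq etaE) (.add (.mul (cst 2) (.sq Bxx1E)) (.mul (cst 4) (.sq Bxy1E)))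

/-- ★ `NhiS/η²`. -/
def Nhi1E : RExpr := .add (.mul (.mul (cst (9/4)) (.sq MNE)) Psi1E) (.mul (cst 12) (.add ZwS1E bulk1E))

/-- ★ THE η-FACTORISED SHARP ROW-C INEQUALITY `9(√(Chi/η²) + √(NhiS/η²))² − 48π²·bC·(2ê₁ − τ)·(3 − (3/2)·Q̂₁/(P̂ν))` (claim `≤ 0`;
`= rowCSE/η²`: the ν-width of a column no longer enters through `η²`). -/
def rowCEF (xshi bC : ℚ) : RExpr :=
  .sub (.mul (cst 9) (.sq (.add (.sqrt (Chi1E xshi)) (.sqrt Nhi1E))))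
    (.mul (.mul (.mul (.mul (cst 48) yPi2) (cst bC)) (.sub (.mul (cst 2) yE1) tauE))
      (.sub (cst 3) (.mul (.mul (.mul (cst (3/2)) yQ) (.inv yP)) (.inv yNu))))


/-- ★ THE η-FACTORISED SHARP ROW-C CELL CHECK (same box and side checks as `rowCCellCheckS`, `rowCEF` for `rowCSE`). -/
def rowCCellCheckF (c : L2.TCell) (a1 a2 xshi bC : ℚ) (pi : ℕ × ℕ) : Bool :=
  match cellFinalBoxCB (c.box a1 a2) 2 pi with
  | none => false
  | some F =>
    decide (F.length = 10) &&
    rexprLeOn (rowCEF xshi bC) 0 (rowCBox c F) pi &&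
    rexprLeOn (.neg yP) (-1) (rowCBox c F) pi &&
    rexprLeOn (.neg tauE) 0 (rowCBox c F) pi &&
    rexprLeOn (.sub tauE (.mul (cst 2) yE1)) 0 (rowCBox c F) pi


section ids

/-- `κ_w = η²κ₁`, `cr = η²cr₁`, `lap = η²lap₁`, `δ = ηδ₁`. -/
theorem ev_kap_cr_lap_del (y : ℕ → ℝ) (hπ : y 1 = Real.pi ^ 2) :
    kapE.eval y = (Real.pi ^ 2 * y 2) ^ 2 * kap1E.eval y ∧ crE.eval y = (Real.pi ^ 2 * y 2) ^ 2 * cr1E.eval y ∧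
    lapE.eval y = (Real.pi ^ 2 * y 2) ^ 2 * lap1E.eval y ∧ delE.eval y = (Real.pi ^ 2 * y 2) * del1E.eval y := by
  obtain ⟨hx, hz⟩ := ev_xi y hπ
  have hc := ev_cs y hπ
  have hπ0 : Real.pi ^ 2 ≠ 0 := by positivity
  refine ⟨?_, ?_, ?_, ?_⟩
  · simp only [kapE, kap1E, etaE, yPi2, yNu, cst, RExpr.eval, hπ] at *; rw [hx, hz]; push_cast; ring
  · simp only [crE, cr1E, etaE, yPi2, yNu, cst, RExpr.eval, hπ] at *; rw [hx, hz]; push_cast; ring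
  · simp only [lapE, lap1E, fourPi2, yPi2, yNu, yA, yT, yX4, cst, RExpr.eval, hπ] at *; rw [hc]; field_simp; push_cast; ring
  · simp only [delE, del1E, etaE, yPi2, yNu, cst, RExpr.eval, hπ] at *; rw [hc]; push_cast; ring


/-- `bulk = η²·bulk₁`. -/
theorem ev_bulk (y : ℕ → ℝ) (hπ : y 1 = Real.pi ^ 2) : bulkE.eval y = (Real.pi ^ 2 * y 2) ^ 2 * bulk1E.eval y := by
  obtain ⟨hx, hz⟩ := ev_xi y hπ
  obtain ⟨-, -, -, hd⟩ := ev_kap_cr_lap_del y hπ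
  have hτ := ev_tau y hπ
  simp only [bulkE, bulk1E, etaE, yPi2, yNu, cst, RExpr.eval, hπ] at *
  rw [hx, hz, hd, hτ]; push_cast; ring


/-- `ZwS = η²·ZwS₁`, `NhiS = η²·Nhi₁`. -/
theorem ev_Nhi (y : ℕ → ℝ) (hπ : y 1 = Real.pi ^ 2) : ZwSE.eval y = (Real.pi ^ 2 * y 2) ^ 2 * ZwS1E.eval y ∧ NhiSE.eval y = (Real.pi ^ 2 * y 2) ^ 2 * Nhi1E.eval y := by
  have hc := ev_cs y hπ
  have hP := ev_Psi y hπ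
  have hB := ev_bulk y hπ
  have hZ : ZwSE.eval y = (Real.pi ^ 2 * y 2) ^ 2 * ZwS1E.eval y := by
    simp only [ZwSE, BxxE, BxyE, ZwS1E, Bxx1E, Bxy1E, etaE, yPi2, yNu, yA, cst, RExpr.eval, hπ] at *
    rw [hc]; push_cast; ring
  refine ⟨hZ, ?_⟩
  simp only [NhiSE, Nhi1E, cst, RExpr.eval] at *
  rw [hZ, hP, hB]; push_cast; ring




/-- ★★ THE MASTER IDENTITY: `rowCSE = η²·rowCEF` at any vector with `y₁ = π²`, `y₂ = ν > 0`. -/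
theorem eval_rowCSE_eq_factor (y : ℕ → ℝ) (hπ : y 1 = Real.pi ^ 2) (hν : 0 < y 2) (xshi bC : ℚ) :
    (rowCSE xshi bC).eval y = (Real.pi ^ 2 * y 2) ^ 2 * (rowCEF xshi bC).eval y := by
  have hC := ev_Chi y hπ hν xshi
  have hN := (ev_Nhi y hπ).2
  set E : ℝ := Real.pi ^ 2 * y 2 with hE
  have hE0 : 0 ≤ E := by positivity
  have hE2 : 0 ≤ E ^ 2 := sq_nonneg _
  have hν0 : y 2 ≠ 0 := hν.ne'
  simp only [rowCSE, rowCEF, etaE, tauE, yPi2, yNu, yE1, yQ, yP, cst, RExpr.eval, hπ] at *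
  rw [hC, hN, Real.sqrt_mul hE2, Real.sqrt_mul hE2, Real.sqrt_sq hE0]
  rw [hE]; field_simp


end ids


end T

end RowC

end Summit.HubbardSuperconductivity.HubbardSuperconductivity.Theorems.AnisotropyChord.Transfer.Fibre3
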